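import Summits.CriticalPhenomena.PercolationContinuityZ3.Theorems.PercNearOneGluingNoHeavyQuantGluedWindowDiagLight
import HarnessLib

/-!
# QUANT lane R8, T-DEC: LEMMA W's two-row regime — the LIGHT-PLUS inequality of the DIAGONAL certificate for every floor (`y ≥ 1/2` by two Handelman
# certificates after the Cauchy–Schwarz reduction), and the floor-free `diag_lightPlus` (arm-1 gen 62, architect)

builds on p205010 (kernel theorem, internal audit signed; external expert review pending)

Support file (`--supports stmt-CriticalPhenomena-4575`), QUANT lane seat prim-quant-arm-1 (gen 62, architect); memo
`run/shared/lean/prim/quant/prim-quant-arm-1-g62/ARCH-G62.md` §2–§3.  Pure real algebra; standard axioms, no sorries, no definitions.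

SETTING as `…QuantGluedWindowDiagLight`: second copy light for `h+r` and not lighter than the pair at `T₀` (`ρ₀ ≤ ρ_1 < y ≤ ν`, `G₁ = y² + (1−y)ρ_1`),
band facts (c11) `(1−y)(ν+ρ_1) ≤ 2ρ₀`, (c12) `2t₀ν + t₁(ν+ρ_1) ≤ 2ρ₀`.  After Cauchy–Schwarz (`diag_cs`) the claim is `s − γs²/R ≤ (1−s)γ(1−y)/y` with
`R = t₀ν + t₁G₁`, increasing in `ν`; `ν ≤ ν_A = (2ρ₀ − t₁ρ_1)/(2s − t₁)` (c12) and `ν ≤ ν_B = 2ρ₀/(1−y) − ρ_1` (c11).  Case `ν_A ≤ ν_B`: the 89-term certificate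
**`diag_lightPlus_bigA_poly`** (kit j310942); case `ν_B ≤ ν_A`: the 97-term certificate **`diag_lightPlus_bigB_poly`** (kit j310943); both in
`(y, ρ₀, ρ_1, s, t₁)`, degree 8, exact rational weights, identities verified exactly (typer g23 / arm-1 g60 pipeline, scaled LP + interior point).
**`diag_lightPlus_big`** (`y ≥ 1/2`) and **`diag_lightPlus`** (every floor; `y ≤ 1/2` is `diag_lightPlus_half`).

HONEST STATUS.  `GluedLemmaW` (flow form), `GluedDominatedMass`, the band, `SiblingStep`, `FarTreeRow` OPEN; RATE class (log\*) / honest sentence of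
`run/shared/lean/prim/quant/README.md` unchanged.  [this work].  Nothing here is cited as a published result.
-/

namespace Summit.CriticalPhenomena.PercolationContinuityZ3.Theorems
namespace Quant
namespace LawDec

set_option maxRecDepth 200000 in
/-- **cleared polynomial, case A** (`ν_A ≤ ν_B`; `r0 = ρ₀`, `r1 = ρ_1`): 89-term Handelman certificate (kit j310942) on
`y−½, 1−y, r0, r1−r0, y−r1, t₁, s−t₁, 1−y−s, ν_A ≥ y, ν_A ≤ ν_B, r0(1+y) − y(1−y)` (the last three cleared of denominators). [this work] -/
theorem diag_lightPlus_bigA_poly (y r0 r1 s t1 : ℝ) (h0 : 0 ≤ y - 1 / 2) (h1 : 0 ≤ 1 - y) (h2 : 0 ≤ r0) (h3 : 0 ≤ r1 - r0) (h4 : 0 ≤ y - r1) (h5 : 0 ≤ t1) (h6 : 0 ≤ s - t1) (h7 : 0 ≤ 1 - y - s) (h8 : 0 ≤ 2 * r0 - t1 * r1 - y * (2 * s - t1)) (h9 : 0 ≤ (2 * r0 - r1 * (1 - y)) * (2 * s - t1) - (2 * r0 - t1 * r1) * (1 - y)) (h10 : 0 ≤ r0 * (1 + y) - y * (1 - y))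 :
    0 ≤ (2 * s - t1) * (y ^ 2 + (1 - y) * r0) * y * s ^ 2 - ((s - t1) * (2 * r0 - t1 * r1) + t1 * (y ^ 2 + (1 - y) * r1) * (2 * s - t1)) * (y * s - (1 - s) * (y ^ 2 + (1 - y) * r0) * (1 - y)) := by
  linarith only [mul_nonneg (mul_nonneg (mul_nonneg (mul_nonneg (mul_nonneg (mul_nonneg (mul_nonneg (mul_nonneg (h0) h0) h0) h0) h4) h5) h5) h5) (by norm_num : (0:ℝ) ≤ 1/3),
    mul_nonneg (mul_nonneg (mul_nonneg (mul_nonneg (mul_nonneg (mul_nonneg (mul_nonneg (mul_nonneg (h0) h0) h0) h0) h4) h5) h5) h6) (by norm_num : (0:ℝ) ≤ 1/3),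
    mul_nonneg (mul_nonneg (mul_nonneg (mul_nonneg (mul_nonneg (mul_nonneg (h0) h0) h0) h1) h4) h5) h5,
    mul_nonneg (mul_nonneg (mul_nonneg (mul_nonneg (mul_nonneg (mul_nonneg (mul_nonneg (h0) h0) h0) h1) h4) h5) h6) (by norm_num : (0:ℝ) ≤ 2),
    mul_nonneg (mul_nonneg (mul_nonneg (mul_nonneg (mul_nonneg (mul_nonneg (mul_nonneg (mul_nonneg (h0) h0) h0) h3) h4) h5) h5) h5) (by norm_num : (0:ℝ) ≤ 2/3),
    mul_nonneg (mul_nonneg (mul_nonneg (mul_nonneg (mul_nonneg (mul_nonneg (mul_nonneg (mul_nonneg (h0) h0) h0) h3) h4) h5) h5) h6) (by norm_num : (0:ℝ) ≤ 8/3),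
    mul_nonneg (mul_nonneg (mul_nonneg (mul_nonneg (mul_nonneg (mul_nonneg (mul_nonneg (mul_nonneg (h0) h0) h0) h3) h4) h5) h6) h6) (by norm_num : (0:ℝ) ≤ 2),
    mul_nonneg (mul_nonneg (mul_nonneg (mul_nonneg (mul_nonneg (mul_nonneg (mul_nonneg (h0) h0) h0) h3) h5) h5) h5) (by norm_num : (0:ℝ) ≤ 1/3),
    mul_nonneg (mul_nonneg (mul_nonneg (mul_nonneg (mul_nonneg (mul_nonneg (mul_nonneg (h0) h0) h0) h3) h5) h5) h6) (by norm_num : (0:ℝ) ≤ 4/3),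
    mul_nonneg (mul_nonneg (mul_nonneg (mul_nonneg (mul_nonneg (mul_nonneg (h0) h0) h0) h3) h5) h6) h6,
    mul_nonneg (mul_nonneg (mul_nonneg (mul_nonneg (mul_nonneg (mul_nonneg (mul_nonneg (mul_nonneg (h0) h0) h0) h4) h4) h5) h5) h5) (by norm_num : (0:ℝ) ≤ 2/3),
    mul_nonneg (mul_nonneg (mul_nonneg (mul_nonneg (mul_nonneg (mul_nonneg (mul_nonneg (mul_nonneg (h0) h0) h0) h4) h4) h5) h5) h6) (by norm_num : (0:ℝ) ≤ 8/3),
    mul_nonneg (mul_nonneg (mul_nonneg (mul_nonneg (mul_nonneg (mul_nonneg (mul_nonneg (mul_nonneg (h0) h0) h0) h4) h4) h5) h6) h6) (by norm_num : (0:ℝ) ≤ 2),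
    mul_nonneg (mul_nonneg (mul_nonneg (mul_nonneg (mul_nonneg (mul_nonneg (mul_nonneg (h0) h0) h0) h4) h5) h5) h5) (by norm_num : (0:ℝ) ≤ 1/3),
    mul_nonneg (mul_nonneg (mul_nonneg (mul_nonneg (mul_nonneg (mul_nonneg (mul_nonneg (h0) h0) h0) h4) h5) h5) h6) (by norm_num : (0:ℝ) ≤ 17/24),
    mul_nonneg (mul_nonneg (mul_nonneg (mul_nonneg (mul_nonneg (mul_nonneg (h0) h0) h0) h4) h5) h6) h6,
    mul_nonneg (mul_nonneg (mul_nonneg (mul_nonneg (mul_nonneg (mul_nonneg (mul_nonneg (mul_nonneg (h0) h0) h1) h2) h4) h5) h5) h5) (by norm_num : (0:ℝ) ≤ 1/3),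
    mul_nonneg (mul_nonneg (mul_nonneg (mul_nonneg (mul_nonneg (mul_nonneg (h0) h0) h1) h3) h5) h5) (by norm_num : (0:ℝ) ≤ 7/12),
    mul_nonneg (mul_nonneg (mul_nonneg (mul_nonneg (mul_nonneg (mul_nonneg (h0) h0) h1) h3) h5) h6) (by norm_num : (0:ℝ) ≤ 7/4),
    mul_nonneg (mul_nonneg (mul_nonneg (mul_nonneg (mul_nonneg (mul_nonneg (h0) h0) h1) h4) h5) h5) (by norm_num : (0:ℝ) ≤ 7/6),
    mul_nonneg (mul_nonneg (mul_nonneg (mul_nonneg (mul_nonneg (mul_nonneg (h0) h0) h1) h4) h5) h6) (by norm_num : (0:ℝ) ≤ 7/2),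
    mul_nonneg (mul_nonneg (mul_nonneg (mul_nonneg (mul_nonneg (h0) h0) h1) h5) h5) (by norm_num : (0:ℝ) ≤ 1/12),
    mul_nonneg (mul_nonneg (mul_nonneg (mul_nonneg (mul_nonneg (mul_nonneg (h0) h0) h3) h5) h5) h5) (by norm_num : (0:ℝ) ≤ 37/72),
    mul_nonneg (mul_nonneg (mul_nonneg (mul_nonneg (mul_nonneg (mul_nonneg (h0) h0) h3) h5) h5) h6) (by norm_num : (0:ℝ) ≤ 101/72),
    mul_nonneg (mul_nonneg (mul_nonneg (mul_nonneg (mul_nonneg (mul_nonneg (h0) h0) h3) h5) h6) h6) (by norm_num : (0:ℝ) ≤ 8/9),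
    mul_nonneg (mul_nonneg (mul_nonneg (mul_nonneg (mul_nonneg (mul_nonneg (h0) h0) h4) h5) h5) h7) (by norm_num : (0:ℝ) ≤ 5/12),
    mul_nonneg (mul_nonneg (mul_nonneg (mul_nonneg (mul_nonneg (mul_nonneg (h0) h0) h4) h5) h6) h7) (by norm_num : (0:ℝ) ≤ 1/4),
    mul_nonneg (mul_nonneg (mul_nonneg (mul_nonneg (mul_nonneg (mul_nonneg (mul_nonneg (h0) h1) h1) h4) h5) h5) h6) (by norm_num : (0:ℝ) ≤ 7/24),
    mul_nonneg (mul_nonneg (mul_nonneg (mul_nonneg (mul_nonneg (mul_nonneg (h0) h1) h2) h2) h5) h5) (by norm_num : (0:ℝ) ≤ 1/6),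
    mul_nonneg (mul_nonneg (mul_nonneg (mul_nonneg (mul_nonneg (mul_nonneg (h0) h1) h2) h2) h5) h6) (by norm_num : (0:ℝ) ≤ 1/2),
    mul_nonneg (mul_nonneg (mul_nonneg (mul_nonneg (mul_nonneg (mul_nonneg (h0) h1) h2) h4) h5) h5) h7,
    mul_nonneg (mul_nonneg (mul_nonneg (mul_nonneg (mul_nonneg (mul_nonneg (mul_nonneg (h0) h1) h2) h4) h5) h6) h7) (by norm_num : (0:ℝ) ≤ 2),
    mul_nonneg (mul_nonneg (mul_nonneg (mul_nonneg (mul_nonneg (mul_nonneg (h0) h1) h3) h3) h5) h5) (by norm_num : (0:ℝ) ≤ 1/2),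
    mul_nonneg (mul_nonneg (mul_nonneg (mul_nonneg (mul_nonneg (mul_nonneg (h0) h1) h3) h3) h5) h6) (by norm_num : (0:ℝ) ≤ 3/2),
    mul_nonneg (mul_nonneg (mul_nonneg (mul_nonneg (mul_nonneg (mul_nonneg (h0) h1) h3) h3) h6) h6) (by norm_num : (0:ℝ) ≤ 2),
    mul_nonneg (mul_nonneg (mul_nonneg (mul_nonneg (mul_nonneg (mul_nonneg (h0) h1) h3) h4) h5) h5) (by norm_num : (0:ℝ) ≤ 1/2),
    mul_nonneg (mul_nonneg (mul_nonneg (mul_nonneg (mul_nonneg (mul_nonneg (h0) h1) h3) h4) h5) h6) (by norm_num : (0:ℝ) ≤ 2),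
    mul_nonneg (mul_nonneg (mul_nonneg (mul_nonneg (mul_nonneg (mul_nonneg (h0) h1) h3) h4) h6) h6) (by norm_num : (0:ℝ) ≤ 4),
    mul_nonneg (mul_nonneg (mul_nonneg (mul_nonneg (mul_nonneg (h0) h1) h3) h5) h5) (by norm_num : (0:ℝ) ≤ 37/72),
    mul_nonneg (mul_nonneg (mul_nonneg (mul_nonneg (mul_nonneg (mul_nonneg (h0) h1) h3) h5) h5) h8) (by norm_num : (0:ℝ) ≤ 1/3),
    mul_nonneg (mul_nonneg (mul_nonneg (mul_nonneg (mul_nonneg (h0) h1) h3) h5) h6) (by norm_num : (0:ℝ) ≤ 25/18),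
    mul_nonneg (mul_nonneg (mul_nonneg (mul_nonneg (mul_nonneg (mul_nonneg (h0) h1) h4) h4) h5) h6) (by norm_num : (0:ℝ) ≤ 1/2),
    mul_nonneg (mul_nonneg (mul_nonneg (mul_nonneg (mul_nonneg (mul_nonneg (h0) h1) h4) h4) h6) h6) (by norm_num : (0:ℝ) ≤ 2),
    mul_nonneg (mul_nonneg (mul_nonneg (mul_nonneg (mul_nonneg (h0) h1) h4) h5) h5) (by norm_num : (0:ℝ) ≤ 1/2),
    mul_nonneg (mul_nonneg (mul_nonneg (mul_nonneg (mul_nonneg (mul_nonneg (h0) h1) h4) h5) h5) h8) (by norm_num : (0:ℝ) ≤ 1/3),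
    mul_nonneg (mul_nonneg (mul_nonneg (mul_nonneg (mul_nonneg (h0) h1) h4) h5) h6) (by norm_num : (0:ℝ) ≤ 5/4),
    mul_nonneg (mul_nonneg (mul_nonneg (mul_nonneg (h0) h1) h5) h5) (by norm_num : (0:ℝ) ≤ 1/12),
    mul_nonneg (mul_nonneg (mul_nonneg (mul_nonneg (mul_nonneg (h0) h1) h5) h5) h8) (by norm_num : (0:ℝ) ≤ 5/16),
    mul_nonneg (mul_nonneg (mul_nonneg (mul_nonneg (mul_nonneg (mul_nonneg (h0) h3) h4) h5) h5) h5) (by norm_num : (0:ℝ) ≤ 5/36),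
    mul_nonneg (mul_nonneg (mul_nonneg (mul_nonneg (mul_nonneg (mul_nonneg (h0) h3) h4) h5) h5) h6) (by norm_num : (0:ℝ) ≤ 5/36),
    mul_nonneg (mul_nonneg (mul_nonneg (mul_nonneg (h0) h3) h6) h7) h8,
    mul_nonneg (mul_nonneg (mul_nonneg (mul_nonneg (mul_nonneg (h0) h4) h5) h5) h6) (by norm_num : (0:ℝ) ≤ 1/96),
    mul_nonneg (mul_nonneg (mul_nonneg (mul_nonneg (mul_nonneg (h0) h4) h5) h5) h7) (by norm_num : (0:ℝ) ≤ 1/12),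
    mul_nonneg (mul_nonneg (mul_nonneg (mul_nonneg (h0) h4) h6) h7) h8,
    mul_nonneg (mul_nonneg (mul_nonneg (mul_nonneg (h0) h6) h7) h8) (by norm_num : (0:ℝ) ≤ 1/2),
    mul_nonneg (mul_nonneg (mul_nonneg (mul_nonneg (mul_nonneg (mul_nonneg (mul_nonneg (mul_nonneg (h1) h1) h1) h2) h4) h5) h5) h6) (by norm_num : (0:ℝ) ≤ 1/3),
    mul_nonneg (mul_nonneg (mul_nonneg (mul_nonneg (mul_nonneg (h1) h2) h2) h5) h6) (by norm_num : (0:ℝ) ≤ 1/4),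
    mul_nonneg (mul_nonneg (mul_nonneg (mul_nonneg (mul_nonneg (mul_nonneg (h1) h2) h4) h5) h5) h6) (by norm_num : (0:ℝ) ≤ 7/24),
    mul_nonneg (mul_nonneg (mul_nonneg (mul_nonneg (mul_nonneg (mul_nonneg (h1) h2) h4) h5) h6) h6) (by norm_num : (0:ℝ) ≤ 1/2),
    mul_nonneg (mul_nonneg (mul_nonneg (mul_nonneg (mul_nonneg (h1) h2) h5) h5) h8) (by norm_num : (0:ℝ) ≤ 5/48),
    mul_nonneg (mul_nonneg (mul_nonneg (mul_nonneg (mul_nonneg (h1) h2) h5) h6) h8) (by norm_num : (0:ℝ) ≤ 1/4),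
    mul_nonneg (mul_nonneg (mul_nonneg (mul_nonneg (mul_nonneg (h1) h3) h3) h5) h5) (by norm_num : (0:ℝ) ≤ 5/72),
    mul_nonneg (mul_nonneg (mul_nonneg (mul_nonneg (mul_nonneg (h1) h3) h3) h5) h6) (by norm_num : (0:ℝ) ≤ 11/18),
    mul_nonneg (mul_nonneg (mul_nonneg (mul_nonneg (h1) h3) h3) h6) h6,
    mul_nonneg (mul_nonneg (mul_nonneg (mul_nonneg (mul_nonneg (h1) h3) h4) h5) h6) (by norm_num : (0:ℝ) ≤ 10/9),
    mul_nonneg (mul_nonneg (mul_nonneg (mul_nonneg (mul_nonneg (h1) h3) h4) h6) h6) (by norm_num : (0:ℝ) ≤ 2),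
    mul_nonneg (mul_nonneg (mul_nonneg (mul_nonneg (h1) h3) h5) h5) (by norm_num : (0:ℝ) ≤ 7/288),
    mul_nonneg (mul_nonneg (mul_nonneg (mul_nonneg (mul_nonneg (h1) h3) h5) h5) h8) (by norm_num : (0:ℝ) ≤ 5/36),
    mul_nonneg (mul_nonneg (mul_nonneg (mul_nonneg (h1) h3) h5) h6) (by norm_num : (0:ℝ) ≤ 23/144),
    mul_nonneg (mul_nonneg (mul_nonneg (mul_nonneg (mul_nonneg (h1) h3) h5) h6) h8) (by norm_num : (0:ℝ) ≤ 13/72),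
    mul_nonneg (mul_nonneg (mul_nonneg (mul_nonneg (mul_nonneg (h1) h4) h4) h5) h6) (by norm_num : (0:ℝ) ≤ 1/2),
    mul_nonneg (mul_nonneg (mul_nonneg (mul_nonneg (h1) h4) h4) h6) h6,
    mul_nonneg (mul_nonneg (mul_nonneg (mul_nonneg (h1) h4) h5) h5) (by norm_num : (0:ℝ) ≤ 5/48),
    mul_nonneg (mul_nonneg (mul_nonneg (mul_nonneg (h1) h4) h5) h6) (by norm_num : (0:ℝ) ≤ 1/8),
    mul_nonneg (mul_nonneg (mul_nonneg (h1) h5) h5) (by norm_num : (0:ℝ) ≤ 1/48),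
    mul_nonneg (mul_nonneg (mul_nonneg (mul_nonneg (mul_nonneg (h1) h5) h5) h7) h10) (by norm_num : (0:ℝ) ≤ 1/12),
    mul_nonneg (mul_nonneg (mul_nonneg (mul_nonneg (h1) h5) h5) h8) (by norm_num : (0:ℝ) ≤ 5/32),
    mul_nonneg (mul_nonneg (mul_nonneg (mul_nonneg (mul_nonneg (h1) h5) h6) h7) h10) (by norm_num : (0:ℝ) ≤ 1/4),
    mul_nonneg (mul_nonneg (mul_nonneg (mul_nonneg (h2) h6) h7) h8) (by norm_num : (0:ℝ) ≤ 1/2),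
    mul_nonneg (mul_nonneg (mul_nonneg (mul_nonneg (mul_nonneg (h3) h4) h5) h5) h7) (by norm_num : (0:ℝ) ≤ 5/72),
    mul_nonneg (mul_nonneg (mul_nonneg (mul_nonneg (mul_nonneg (h3) h4) h5) h6) h7) (by norm_num : (0:ℝ) ≤ 1/4),
    mul_nonneg (mul_nonneg (mul_nonneg (mul_nonneg (h3) h5) h5) h7) (by norm_num : (0:ℝ) ≤ 49/288),
    mul_nonneg (mul_nonneg (mul_nonneg (mul_nonneg (h3) h5) h6) h7) (by norm_num : (0:ℝ) ≤ 25/72),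
    mul_nonneg (mul_nonneg (mul_nonneg (mul_nonneg (mul_nonneg (h4) h4) h5) h6) h7) (by norm_num : (0:ℝ) ≤ 1/4),
    mul_nonneg (mul_nonneg (mul_nonneg (mul_nonneg (mul_nonneg (h4) h5) h5) h5) h10) (by norm_num : (0:ℝ) ≤ 1/48),
    mul_nonneg (mul_nonneg (mul_nonneg (mul_nonneg (h4) h5) h5) h6) (by norm_num : (0:ℝ) ≤ 7/96),
    mul_nonneg (mul_nonneg (mul_nonneg (mul_nonneg (h4) h5) h5) h9) (by norm_num : (0:ℝ) ≤ 1/48),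
    mul_nonneg (mul_nonneg (mul_nonneg (mul_nonneg (h4) h5) h6) h7) (by norm_num : (0:ℝ) ≤ 1/16),
    mul_nonneg (mul_nonneg (mul_nonneg (h6) h7) h8) (by norm_num : (0:ℝ) ≤ 1/4)]

set_option maxRecDepth 200000 in
/-- **cleared polynomial, case B** (`ν_B ≤ ν_A`): 97-term Handelman certificate (kit j310943) on
`y−½, 1−y, r0, r1−r0, y−r1, t₁, s−t₁, 1−y−s, ν_B ≥ y, ν_B ≤ ν_A, r0(1+y) − y(1−y)` (cleared of denominators). [this work] -/
theorem diag_lightPlus_bigB_poly (y r0 r1 s t1 : ℝ) (h0 : 0 ≤ y - 1 / 2) (h1 : 0 ≤ 1 - y) (h2 : 0 ≤ r0) (h3 : 0 ≤ r1 - r0) (h4 : 0 ≤ y - r1) (h5 : 0 ≤ t1) (h6 : 0 ≤ s - t1) (h7 : 0 ≤ 1 - y - s) (h8 : 0 ≤ 2 * r0 - r1 * (1 - y) - y * (1 - y)) (h9 : 0 ≤ r0 * (1 - y) - (s - t1) * (2 * r0 - r1 * (1 - y)) - t1 * r0) (h10 : 0 ≤ r0 * (1 + y) - y * (1 - y)) 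:
    0 ≤ (1 - y) * (y ^ 2 + (1 - y) * r0) * y * s ^ 2 - ((s - t1) * (2 * r0 - r1 * (1 - y)) + t1 * (y ^ 2 + (1 - y) * r1) * (1 - y)) * (y * s - (1 - s) * (y ^ 2 + (1 - y) * r0) * (1 - y)) := by
  linarith only [mul_nonneg (mul_nonneg (mul_nonneg (mul_nonneg (mul_nonneg (mul_nonneg (h0) h0) h0) h1) h1) h4) h5,
    mul_nonneg (mul_nonneg (mul_nonneg (mul_nonneg (mul_nonneg (mul_nonneg (mul_nonneg (mul_nonneg (h0) h0) h0) h1) h3) h4) h5) h5) (by norm_num : (0:ℝ) ≤ 11/15),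
    mul_nonneg (mul_nonneg (mul_nonneg (mul_nonneg (mul_nonneg (mul_nonneg (mul_nonneg (h0) h0) h0) h1) h3) h4) h5) h6,
    mul_nonneg (mul_nonneg (mul_nonneg (mul_nonneg (mul_nonneg (mul_nonneg (h0) h0) h0) h1) h3) h5) h5,
    mul_nonneg (mul_nonneg (mul_nonneg (mul_nonneg (mul_nonneg (mul_nonneg (mul_nonneg (mul_nonneg (h0) h0) h0) h1) h4) h4) h5) h5) (by norm_num : (0:ℝ) ≤ 13/15),
    mul_nonneg (mul_nonneg (mul_nonneg (mul_nonneg (mul_nonneg (mul_nonneg (mul_nonneg (h0) h0) h0) h1) h4) h4) h5) h6,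
    mul_nonneg (mul_nonneg (mul_nonneg (mul_nonneg (mul_nonneg (mul_nonneg (mul_nonneg (h0) h0) h0) h1) h4) h5) h5) (by norm_num : (0:ℝ) ≤ 583/2370),
    mul_nonneg (mul_nonneg (mul_nonneg (mul_nonneg (mul_nonneg (mul_nonneg (mul_nonneg (h0) h0) h0) h1) h4) h5) h6) (by norm_num : (0:ℝ) ≤ 1/2),
    mul_nonneg (mul_nonneg (mul_nonneg (mul_nonneg (mul_nonneg (mul_nonneg (mul_nonneg (h0) h0) h0) h2) h4) h6) h6) (by norm_num : (0:ℝ) ≤ 439/948),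
    mul_nonneg (mul_nonneg (mul_nonneg (mul_nonneg (mul_nonneg (mul_nonneg (h0) h0) h0) h2) h6) h6) (by norm_num : (0:ℝ) ≤ 35/316),
    mul_nonneg (mul_nonneg (mul_nonneg (mul_nonneg (mul_nonneg (mul_nonneg (h0) h0) h0) h6) h6) h8) (by norm_num : (0:ℝ) ≤ 43/474),
    mul_nonneg (mul_nonneg (mul_nonneg (mul_nonneg (mul_nonneg (mul_nonneg (mul_nonneg (mul_nonneg (h0) h0) h1) h1) h2) h4) h5) h5) (by norm_num : (0:ℝ) ≤ 4/15),
    mul_nonneg (mul_nonneg (mul_nonneg (mul_nonneg (mul_nonneg (h0) h0) h1) h1) h3) h5,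
    mul_nonneg (mul_nonneg (mul_nonneg (mul_nonneg (mul_nonneg (mul_nonneg (h0) h0) h1) h1) h3) h6) (by norm_num : (0:ℝ) ≤ 123/316),
    mul_nonneg (mul_nonneg (mul_nonneg (mul_nonneg (mul_nonneg (mul_nonneg (h0) h0) h1) h1) h4) h5) (by norm_num : (0:ℝ) ≤ 469/395),
    mul_nonneg (mul_nonneg (mul_nonneg (mul_nonneg (mul_nonneg (mul_nonneg (h0) h0) h1) h1) h4) h6) (by norm_num : (0:ℝ) ≤ 20/79),
    mul_nonneg (mul_nonneg (mul_nonneg (mul_nonneg (mul_nonneg (h0) h0) h1) h1) h5) (by norm_num : (0:ℝ) ≤ 1/158),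
    mul_nonneg (mul_nonneg (mul_nonneg (mul_nonneg (mul_nonneg (mul_nonneg (mul_nonneg (h0) h0) h1) h3) h4) h5) h6) (by norm_num : (0:ℝ) ≤ 1/2),
    mul_nonneg (mul_nonneg (mul_nonneg (mul_nonneg (mul_nonneg (mul_nonneg (h0) h0) h1) h3) h5) h5) (by norm_num : (0:ℝ) ≤ 1/2),
    mul_nonneg (mul_nonneg (mul_nonneg (mul_nonneg (mul_nonneg (mul_nonneg (mul_nonneg (h0) h0) h1) h4) h4) h6) h6) (by norm_num : (0:ℝ) ≤ 313/1896),
    mul_nonneg (mul_nonneg (mul_nonneg (mul_nonneg (mul_nonneg (mul_nonneg (mul_nonneg (h0) h0) h1) h4) h5) h5) h8) (by norm_num : (0:ℝ) ≤ 2/15),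
    mul_nonneg (mul_nonneg (mul_nonneg (mul_nonneg (mul_nonneg (mul_nonneg (h0) h0) h1) h4) h5) h6) (by norm_num : (0:ℝ) ≤ 299/1580),
    mul_nonneg (mul_nonneg (mul_nonneg (mul_nonneg (mul_nonneg (mul_nonneg (h0) h0) h1) h4) h5) h7) (by norm_num : (0:ℝ) ≤ 247/790),
    mul_nonneg (mul_nonneg (mul_nonneg (mul_nonneg (mul_nonneg (mul_nonneg (h0) h0) h1) h4) h6) h6) (by norm_num : (0:ℝ) ≤ 1/4),
    mul_nonneg (mul_nonneg (mul_nonneg (mul_nonneg (mul_nonneg (h0) h0) h2) h3) h6) h6,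
    mul_nonneg (mul_nonneg (mul_nonneg (mul_nonneg (mul_nonneg (mul_nonneg (h0) h0) h2) h4) h6) h6) (by norm_num : (0:ℝ) ≤ 91/79),
    mul_nonneg (mul_nonneg (mul_nonneg (mul_nonneg (mul_nonneg (h0) h0) h2) h6) h6) (by norm_num : (0:ℝ) ≤ 35/632),
    mul_nonneg (mul_nonneg (mul_nonneg (mul_nonneg (mul_nonneg (h0) h0) h2) h6) h9) (by norm_num : (0:ℝ) ≤ 35/474),
    mul_nonneg (mul_nonneg (mul_nonneg (mul_nonneg (mul_nonneg (mul_nonneg (h0) h0) h3) h6) h6) h8) (by norm_num : (0:ℝ) ≤ 247/948),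
    mul_nonneg (mul_nonneg (mul_nonneg (mul_nonneg (mul_nonneg (mul_nonneg (mul_nonneg (h0) h1) h1) h1) h4) h5) h5) (by norm_num : (0:ℝ) ≤ 73/474),
    mul_nonneg (mul_nonneg (mul_nonneg (mul_nonneg (mul_nonneg (mul_nonneg (h0) h1) h1) h2) h4) h5) h7,
    mul_nonneg (mul_nonneg (mul_nonneg (mul_nonneg (mul_nonneg (mul_nonneg (h0) h1) h1) h3) h4) h6) (by norm_num : (0:ℝ) ≤ 695/1896),
    mul_nonneg (mul_nonneg (mul_nonneg (mul_nonneg (mul_nonneg (h0) h1) h1) h3) h5) (by norm_num : (0:ℝ) ≤ 3/4),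
    mul_nonneg (mul_nonneg (mul_nonneg (mul_nonneg (mul_nonneg (mul_nonneg (h0) h1) h1) h4) h4) h6) (by norm_num : (0:ℝ) ≤ 113/237),
    mul_nonneg (mul_nonneg (mul_nonneg (mul_nonneg (mul_nonneg (h0) h1) h1) h4) h5) (by norm_num : (0:ℝ) ≤ 1/4),
    mul_nonneg (mul_nonneg (mul_nonneg (mul_nonneg (mul_nonneg (h0) h1) h1) h4) h6) (by norm_num : (0:ℝ) ≤ 29/158),
    mul_nonneg (mul_nonneg (mul_nonneg (mul_nonneg (h0) h1) h1) h5) (by norm_num : (0:ℝ) ≤ 1/316),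
    mul_nonneg (mul_nonneg (mul_nonneg (mul_nonneg (mul_nonneg (mul_nonneg (h0) h1) h2) h2) h5) h6) (by norm_num : (0:ℝ) ≤ 41/316),
    mul_nonneg (mul_nonneg (mul_nonneg (mul_nonneg (mul_nonneg (mul_nonneg (h0) h1) h2) h6) h6) h8) (by norm_num : (0:ℝ) ≤ 16/79),
    mul_nonneg (mul_nonneg (mul_nonneg (mul_nonneg (mul_nonneg (h0) h1) h2) h6) h7) (by norm_num : (0:ℝ) ≤ 19/1896),
    mul_nonneg (mul_nonneg (mul_nonneg (mul_nonneg (mul_nonneg (mul_nonneg (h0) h1) h3) h3) h5) h6) (by norm_num : (0:ℝ) ≤ 117/158),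
    mul_nonneg (mul_nonneg (mul_nonneg (mul_nonneg (mul_nonneg (mul_nonneg (h0) h1) h3) h4) h5) h5) (by norm_num : (0:ℝ) ≤ 1/30),
    mul_nonneg (mul_nonneg (mul_nonneg (mul_nonneg (mul_nonneg (mul_nonneg (h0) h1) h3) h4) h5) h6) (by norm_num : (0:ℝ) ≤ 1651/1896),
    mul_nonneg (mul_nonneg (mul_nonneg (mul_nonneg (mul_nonneg (h0) h1) h3) h6) h6) (by norm_num : (0:ℝ) ≤ 1/4),
    mul_nonneg (mul_nonneg (mul_nonneg (mul_nonneg (mul_nonneg (mul_nonneg (h0) h1) h4) h4) h5) h6) (by norm_num : (0:ℝ) ≤ 64/237),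
    mul_nonneg (mul_nonneg (mul_nonneg (mul_nonneg (mul_nonneg (mul_nonneg (h0) h1) h4) h5) h5) h8) (by norm_num : (0:ℝ) ≤ 1/15),
    mul_nonneg (mul_nonneg (mul_nonneg (mul_nonneg (mul_nonneg (mul_nonneg (h0) h1) h4) h5) h5) h10) (by norm_num : (0:ℝ) ≤ 1/10),
    mul_nonneg (mul_nonneg (mul_nonneg (mul_nonneg (mul_nonneg (h0) h1) h4) h5) h9) (by norm_num : (0:ℝ) ≤ 1/2),
    mul_nonneg (mul_nonneg (mul_nonneg (mul_nonneg (mul_nonneg (h0) h1) h4) h6) h6) (by norm_num : (0:ℝ) ≤ 43/474),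
    mul_nonneg (mul_nonneg (mul_nonneg (mul_nonneg (mul_nonneg (h0) h1) h4) h6) h9) (by norm_num : (0:ℝ) ≤ 161/948),
    mul_nonneg (mul_nonneg (mul_nonneg (mul_nonneg (h0) h1) h5) h5) (by norm_num : (0:ℝ) ≤ 1/316),
    mul_nonneg (mul_nonneg (mul_nonneg (mul_nonneg (mul_nonneg (h0) h1) h5) h5) h8) (by norm_num : (0:ℝ) ≤ 1/2),
    mul_nonneg (mul_nonneg (mul_nonneg (mul_nonneg (h0) h1) h5) h7) (by norm_num : (0:ℝ) ≤ 41/632),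
    mul_nonneg (mul_nonneg (mul_nonneg (mul_nonneg (h0) h1) h5) h9) (by norm_num : (0:ℝ) ≤ 40/79),
    mul_nonneg (mul_nonneg (mul_nonneg (mul_nonneg (h0) h1) h6) h9) (by norm_num : (0:ℝ) ≤ 359/948),
    mul_nonneg (mul_nonneg (mul_nonneg (mul_nonneg (mul_nonneg (h0) h2) h4) h6) h6) (by norm_num : (0:ℝ) ≤ 87/1264),
    mul_nonneg (mul_nonneg (mul_nonneg (mul_nonneg (mul_nonneg (h0) h3) h6) h7) h8) (by norm_num : (0:ℝ) ≤ 1247/1896),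
    mul_nonneg (mul_nonneg (mul_nonneg (mul_nonneg (mul_nonneg (h0) h3) h6) h7) h10) (by norm_num : (0:ℝ) ≤ 35/474),
    mul_nonneg (mul_nonneg (mul_nonneg (mul_nonneg (mul_nonneg (h0) h4) h6) h7) h8) (by norm_num : (0:ℝ) ≤ 173/316),
    mul_nonneg (mul_nonneg (mul_nonneg (mul_nonneg (mul_nonneg (h0) h4) h6) h7) h10) (by norm_num : (0:ℝ) ≤ 173/948),
    mul_nonneg (mul_nonneg (mul_nonneg (mul_nonneg (mul_nonneg (h0) h6) h6) h8) h8) (by norm_num : (0:ℝ) ≤ 47/632),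
    mul_nonneg (mul_nonneg (mul_nonneg (mul_nonneg (h0) h6) h7) h8) (by norm_num : (0:ℝ) ≤ 117/316),
    mul_nonneg (mul_nonneg (mul_nonneg (h0) h6) h9) (by norm_num : (0:ℝ) ≤ 56/237),
    mul_nonneg (mul_nonneg (mul_nonneg (mul_nonneg (mul_nonneg (h1) h1) h2) h5) h6) (by norm_num : (0:ℝ) ≤ 1/316),
    mul_nonneg (mul_nonneg (mul_nonneg (mul_nonneg (mul_nonneg (h1) h1) h3) h3) h6) (by norm_num : (0:ℝ) ≤ 275/632),
    mul_nonneg (mul_nonneg (mul_nonneg (mul_nonneg (mul_nonneg (h1) h1) h3) h4) h5) (by norm_num : (0:ℝ) ≤ 1/4),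
    mul_nonneg (mul_nonneg (mul_nonneg (mul_nonneg (mul_nonneg (h1) h1) h3) h4) h6) (by norm_num : (0:ℝ) ≤ 473/632),
    mul_nonneg (mul_nonneg (mul_nonneg (mul_nonneg (h1) h1) h3) h5) (by norm_num : (0:ℝ) ≤ 117/1264),
    mul_nonneg (mul_nonneg (mul_nonneg (mul_nonneg (mul_nonneg (h1) h1) h4) h4) h5) (by norm_num : (0:ℝ) ≤ 1/4),
    mul_nonneg (mul_nonneg (mul_nonneg (mul_nonneg (mul_nonneg (h1) h1) h4) h4) h6) (by norm_num : (0:ℝ) ≤ 99/316),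
    mul_nonneg (mul_nonneg (mul_nonneg (mul_nonneg (mul_nonneg (mul_nonneg (h1) h2) h2) h2) h5) h6) (by norm_num : (0:ℝ) ≤ 119/316),
    mul_nonneg (mul_nonneg (mul_nonneg (mul_nonneg (mul_nonneg (mul_nonneg (h1) h2) h2) h4) h5) h6) (by norm_num : (0:ℝ) ≤ 20/79),
    mul_nonneg (mul_nonneg (mul_nonneg (mul_nonneg (mul_nonneg (h1) h2) h2) h6) h7) (by norm_num : (0:ℝ) ≤ 41/632),
    mul_nonneg (mul_nonneg (mul_nonneg (mul_nonneg (mul_nonneg (h1) h2) h4) h5) h5) (by norm_num : (0:ℝ) ≤ 1/8),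
    mul_nonneg (mul_nonneg (mul_nonneg (mul_nonneg (mul_nonneg (h1) h2) h6) h7) h8) (by norm_num : (0:ℝ) ≤ 35/948),
    mul_nonneg (mul_nonneg (mul_nonneg (mul_nonneg (mul_nonneg (mul_nonneg (h1) h3) h3) h3) h5) h6) (by norm_num : (0:ℝ) ≤ 119/316),
    mul_nonneg (mul_nonneg (mul_nonneg (mul_nonneg (mul_nonneg (mul_nonneg (h1) h3) h3) h4) h5) h6) (by norm_num : (0:ℝ) ≤ 277/316),
    mul_nonneg (mul_nonneg (mul_nonneg (mul_nonneg (mul_nonneg (h1) h3) h3) h6) h6) (by norm_num : (0:ℝ) ≤ 41/632),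
    mul_nonneg (mul_nonneg (mul_nonneg (mul_nonneg (mul_nonneg (mul_nonneg (h1) h3) h4) h4) h5) h6) (by norm_num : (0:ℝ) ≤ 197/316),
    mul_nonneg (mul_nonneg (mul_nonneg (mul_nonneg (mul_nonneg (h1) h3) h4) h6) h6) (by norm_num : (0:ℝ) ≤ 159/632),
    mul_nonneg (mul_nonneg (mul_nonneg (mul_nonneg (h1) h3) h5) h5) (by norm_num : (0:ℝ) ≤ 33/1264),
    mul_nonneg (mul_nonneg (mul_nonneg (mul_nonneg (h1) h3) h5) h7) (by norm_num : (0:ℝ) ≤ 271/1264),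
    mul_nonneg (mul_nonneg (mul_nonneg (mul_nonneg (mul_nonneg (mul_nonneg (h1) h4) h4) h4) h5) h6) (by norm_num : (0:ℝ) ≤ 39/316),
    mul_nonneg (mul_nonneg (mul_nonneg (mul_nonneg (mul_nonneg (h1) h4) h4) h6) h6) (by norm_num : (0:ℝ) ≤ 393/2528),
    mul_nonneg (mul_nonneg (mul_nonneg (mul_nonneg (h1) h4) h5) h5) (by norm_num : (0:ℝ) ≤ 73/1264),
    mul_nonneg (mul_nonneg (mul_nonneg (mul_nonneg (h1) h4) h5) h7) (by norm_num : (0:ℝ) ≤ 9/158),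
    mul_nonneg (mul_nonneg (mul_nonneg (mul_nonneg (h1) h4) h6) h7) (by norm_num : (0:ℝ) ≤ 195/2528),
    mul_nonneg (mul_nonneg (mul_nonneg (h1) h5) h5) (by norm_num : (0:ℝ) ≤ 1/632),
    mul_nonneg (mul_nonneg (mul_nonneg (mul_nonneg (h1) h5) h5) h8) (by norm_num : (0:ℝ) ≤ 39/158),
    mul_nonneg (mul_nonneg (mul_nonneg (h1) h5) h7) (by norm_num : (0:ℝ) ≤ 41/1264),
    mul_nonneg (mul_nonneg (mul_nonneg (mul_nonneg (h1) h5) h7) h10) (by norm_num : (0:ℝ) ≤ 77/316),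
    mul_nonneg (mul_nonneg (mul_nonneg (h1) h5) h9) (by norm_num : (0:ℝ) ≤ 121/632),
    mul_nonneg (mul_nonneg (mul_nonneg (mul_nonneg (h2) h4) h6) h7) (by norm_num : (0:ℝ) ≤ 1/632),
    mul_nonneg (mul_nonneg (mul_nonneg (mul_nonneg (h2) h6) h7) h8) (by norm_num : (0:ℝ) ≤ 169/474),
    mul_nonneg (mul_nonneg (mul_nonneg (mul_nonneg (h6) h6) h8) h8) (by norm_num : (0:ℝ) ≤ 1/16),
    mul_nonneg (mul_nonneg (mul_nonneg (h6) h7) h8) (by norm_num : (0:ℝ) ≤ 591/2528),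
    mul_nonneg (mul_nonneg (h6) h9) (by norm_num : (0:ℝ) ≤ 5/16)]

/-- **LIGHT-PLUS INEQUALITY, floor `y ≥ 1/2`**: `1/2 ≤ y < 1`, `0 < ρ₀ ≤ ρ_1 ≤ y ≤ ν`, `t₀, t₁ ≥ 0`, `t₀ + t₁ ≤ 1 − y`, (c11) `(1−y)(ν+ρ_1) ≤ 2ρ₀`,
(c12) `2t₀ν + t₁(ν+ρ_1) ≤ 2ρ₀` ⟹ `t₀(1 − γ/ν) + t₁(1 − γ/G₁) ≤ (1−t₀−t₁)·γ·(1−y)/y`. [this work] -/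
theorem diag_lightPlus_big (y ρ ρ1 t0 t1 n : ℝ) (hyh : 1 / 2 ≤ y) (hy1 : y < 1) (hρ0 : 0 < ρ) (hρ1 : ρ ≤ ρ1) (hρ1y : ρ1 ≤ y) (hn : y ≤ n)
    (ht0 : 0 ≤ t0) (ht1 : 0 ≤ t1) (hs1 : t0 + t1 ≤ 1 - y) (hc11 : (1 - y) * (n + ρ1) ≤ 2 * ρ) (hc12 : 2 * t0 * n + t1 * (n + ρ1) ≤ 2 * ρ) :
    t0 * (1 - (y ^ 2 + (1 - y) * ρ) / n) + t1 * (1 - (y ^ 2 + (1 - y) * ρ) / (y ^ 2 + (1 - y) * ρ1))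
      ≤ (1 - t0 - t1) * (y ^ 2 + (1 - y) * ρ) * ((1 - y) / y) := by
  obtain ⟨g, hg⟩ : ∃ g : ℝ, g = y ^ 2 + (1 - y) * ρ := ⟨_, rfl⟩
  obtain ⟨G1, hG1⟩ : ∃ G1 : ℝ, G1 = y ^ 2 + (1 - y) * ρ1 := ⟨_, rfl⟩
  have hy0 : 0 < y := by linarith
  have h1y : 0 < 1 - y := by linarith
  have hg0 : 0 < g := by rw [hg]; positivity
  have hn0 : 0 < n := lt_of_lt_of_le hy0 hn
  have hρ10 : 0 ≤ ρ1 := by linarith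
  have hG10 : 0 < G1 := by rw [hG1]; positivity
  have hρy : ρ ≤ y := le_trans hρ1 hρ1y
  rw [← hg, ← hG1]
  obtain ⟨s, hs⟩ : ∃ s : ℝ, s = t0 + t1 := ⟨_, rfl⟩
  rcases eq_or_lt_of_le (show 0 ≤ s by rw [hs]; linarith) with hs0 | hs0
  · have e0 : t0 = 0 := by linarith
    have e1 : t1 = 0 := by linarith
    rw [e0, e1]; simp only [zero_mul, add_zero, sub_zero, one_mul]
    exact mul_nonneg hg0.le (div_nonneg h1y.le hy0.le)
  have hCS := diag_cs g t0 t1 n G1 hg0.le ht0 ht1 (by rw [← hs]; exact hs0) hn0 hG10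
  rw [← hs] at hCS
  obtain ⟨R, hR⟩ : ∃ R : ℝ, R = t0 * n + t1 * G1 := ⟨_, rfl⟩
  rw [← hR] at hCS
  have hRpos : 0 < R := by
    rw [hR]; rcases lt_or_ge 0 t0 with h | h
    · exact add_pos_of_pos_of_nonneg (mul_pos h hn0) (mul_nonneg ht1 hG10.le)
    · have : 0 < t1 := by linarith [le_antisymm h ht0]
      exact add_pos_of_nonneg_of_pos (mul_nonneg ht0 hn0.le) (mul_pos this hG10)
  have e14 : 1 - t0 - t1 = 1 - s := by rw [hs]; ring
  rw [e14]
  have et0 : t0 = s - t1 := by rw [hs]; ring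
  have h2s : 0 < 2 * s - t1 := by linarith
  -- the two bounds on ν (cleared): ν(2s − t1) ≤ 2ρ − t1ρ1 and ν(1−y) ≤ 2ρ − ρ1(1−y)
  have hnA : n * (2 * s - t1) ≤ 2 * ρ - t1 * ρ1 := by
    have e : n * (2 * s - t1) = 2 * t0 * n + t1 * (n + ρ1) - t1 * ρ1 := by rw [hs]; ring
    rw [e]; linarith
  have hnB : n * (1 - y) ≤ 2 * ρ - ρ1 * (1 - y) := by
    have e : n * (1 - y) = (1 - y) * (n + ρ1) - ρ1 * (1 - y) := by ring
    rw [e]; linarith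
  have hc11b : 0 ≤ ρ * (1 + y) - y * (1 - y) := by
    have h1 := mul_le_mul_of_nonneg_left (add_le_add hn hρ1) h1y.le
    have e : (1 - y) * (y + ρ) = y * (1 - y) + ρ - ρ * y := by ring
    have e' : ρ * (1 + y) = ρ + ρ * y := by ring
    linarith [h1, hc11, e, e']
  -- from "γys² − R_X·K ≥ 0" and R ≤ R_X to the claim
  obtain ⟨K, hK⟩ : ∃ K : ℝ, K = y * s - (1 - s) * g * (1 - y) := ⟨_, rfl⟩
  have finish : ∀ RX : ℝ, R ≤ RX → 0 ≤ g * y * s ^ 2 - RX * K → s - g * s ^ 2 / R ≤ (1 - s) * g * ((1 - y) / y) := by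
    intro RX hRX hP
    rcases le_or_gt K 0 with hK0 | hK0
    · have : 0 ≤ g * s ^ 2 / R := by positivity
      have h2 : s * y ≤ (1 - s) * g * ((1 - y) / y) * y := by
        rw [show (1 - s) * g * ((1 - y) / y) * y = (1 - s) * g * (1 - y) by field_simp]; rw [hK] at hK0; linarith
      have h3 := le_of_mul_le_mul_right h2 hy0
      linarith
    · have h1 : R * K ≤ g * y * s ^ 2 := by nlinarith [mul_le_mul_of_nonneg_right hRX hK0.le]
      have h2 : (s - g * s ^ 2 / R) * (R * y) ≤ (1 - s) * g * ((1 - y) / y) * (R * y) := by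
        have e1 : (s - g * s ^ 2 / R) * (R * y) = y * s * R - g * y * s ^ 2 := by
          rw [sub_mul, show g * s ^ 2 / R * (R * y) = (g * s ^ 2 / R * R) * y by ring, div_mul_cancel₀ _ hRpos.ne']; ring
        have e2 : (1 - s) * g * ((1 - y) / y) * (R * y) = (1 - s) * g * (1 - y) * R := by
          rw [show (1 - s) * g * ((1 - y) / y) * (R * y) = (1 - s) * g * R * ((1 - y) / y * y) by ring, div_mul_cancel₀ _ hy0.ne']; ring
        rw [e1, e2]; rw [hK] at h1; nlinarith [h1]
      exact le_of_mul_le_mul_right h2 (mul_pos hRpos hy0)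
  by_cases hAB : (2 * ρ - t1 * ρ1) * (1 - y) ≤ (2 * ρ - ρ1 * (1 - y)) * (2 * s - t1)
  · -- case A: R (2s − t1) ≤ (s − t1)(2ρ − t1ρ1) + t1 G1 (2s − t1) =: RA'
    have hRA : R * (2 * s - t1) ≤ (s - t1) * (2 * ρ - t1 * ρ1) + t1 * G1 * (2 * s - t1) := by
      have h := mul_le_mul_of_nonneg_left hnA (show 0 ≤ s - t1 by rw [hs]; linarith)
      have e : R * (2 * s - t1) = (s - t1) * (n * (2 * s - t1)) + t1 * G1 * (2 * s - t1) := by rw [hR, et0]; ring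
      rw [e]; linarith [h]
    have hnAy : 0 ≤ 2 * ρ - t1 * ρ1 - y * (2 * s - t1) := by
      have h := mul_le_mul_of_nonneg_right hn h2s.le
      linarith [h, hnA]
    have P := diag_lightPlus_bigA_poly y ρ ρ1 s t1 (by linarith) h1y.le hρ0.le (by linarith) (by linarith) ht1 (by rw [hs]; linarith)
      (by rw [hs]; linarith) hnAy (by linarith) hc11b
    rw [← hg, ← hG1] at P
    refine le_trans hCS (finish (((s - t1) * (2 * ρ - t1 * ρ1) + t1 * G1 * (2 * s - t1)) / (2 * s - t1)) ((le_div_iff₀ h2s).2 hRA) ?_)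
    have e : g * y * s ^ 2 - ((s - t1) * (2 * ρ - t1 * ρ1) + t1 * G1 * (2 * s - t1)) / (2 * s - t1) * K
        = ((2 * s - t1) * g * y * s ^ 2 - ((s - t1) * (2 * ρ - t1 * ρ1) + t1 * G1 * (2 * s - t1)) * K) / (2 * s - t1) := by
      rw [div_mul_eq_mul_div, sub_div' h2s.ne']; congr 1; ring
    rw [e, hK]; exact div_nonneg P h2s.le
  · -- case B: R (1−y) ≤ (s − t1)(2ρ − ρ1(1−y)) + t1 G1 (1−y)
    have hBA : (2 * ρ - ρ1 * (1 - y)) * (2 * s - t1) ≤ (2 * ρ - t1 * ρ1) * (1 - y) := (lt_of_not_ge hAB).le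
    have hRB : R * (1 - y) ≤ (s - t1) * (2 * ρ - ρ1 * (1 - y)) + t1 * G1 * (1 - y) := by
      have h := mul_le_mul_of_nonneg_left hnB (show 0 ≤ s - t1 by rw [hs]; linarith)
      have e : R * (1 - y) = (s - t1) * (n * (1 - y)) + t1 * G1 * (1 - y) := by rw [hR, et0]; ring
      rw [e]; linarith [h]
    have hc12B : 0 ≤ ρ * (1 - y) - (s - t1) * (2 * ρ - ρ1 * (1 - y)) - t1 * ρ := by
      -- ν_B ≤ ν_A, i.e. c12 at ν_B
      have e : (2 * ρ - t1 * ρ1) * (1 - y) - (2 * ρ - ρ1 * (1 - y)) * (2 * s - t1)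
          = 2 * (ρ * (1 - y) - (s - t1) * (2 * ρ - ρ1 * (1 - y)) - t1 * ρ) := by ring
      linarith [hBA, e]
    have hnBy : 0 ≤ 2 * ρ - ρ1 * (1 - y) - y * (1 - y) := by
      have h := mul_le_mul_of_nonneg_right hn h1y.le
      linarith [h, hnB]
    have P := diag_lightPlus_bigB_poly y ρ ρ1 s t1 (by linarith) h1y.le hρ0.le (by linarith) (by linarith) ht1 (by rw [hs]; linarith)
      (by rw [hs]; linarith) hnBy hc12B hc11b
    rw [← hg, ← hG1] at P
    refine le_trans hCS (finish (((s - t1) * (2 * ρ - ρ1 * (1 - y)) + t1 * G1 * (1 - y)) / (1 - y)) ((le_div_iff₀ h1y).2 hRB) ?_)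
    have e : g * y * s ^ 2 - ((s - t1) * (2 * ρ - ρ1 * (1 - y)) + t1 * G1 * (1 - y)) / (1 - y) * K
        = ((1 - y) * g * y * s ^ 2 - ((s - t1) * (2 * ρ - ρ1 * (1 - y)) + t1 * G1 * (1 - y)) * K) / (1 - y) := by
      rw [div_mul_eq_mul_div, sub_div' h1y.ne']; congr 1; ring
    rw [e, hK]; exact div_nonneg P h1y.le

/-- **LIGHT-PLUS INEQUALITY (every floor)**: `0 < y < 1`, `0 < ρ₀ ≤ ρ_1 ≤ y ≤ ν`, `t₀, t₁ ≥ 0`, `t₀ + t₁ ≤ 1 − y`, (c11), (c12) ⟹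
`t₀(1 − γ/ν) + t₁(1 − γ/G₁) ≤ (1−t₀−t₁)·γ·(1−y)/y`. [this work] -/
theorem diag_lightPlus (y ρ ρ1 t0 t1 n : ℝ) (hy0 : 0 < y) (hy1 : y < 1) (hρ0 : 0 < ρ) (hρ1 : ρ ≤ ρ1) (hρ1y : ρ1 ≤ y) (hn : y ≤ n)
    (ht0 : 0 ≤ t0) (ht1 : 0 ≤ t1) (hs1 : t0 + t1 ≤ 1 - y) (hc11 : (1 - y) * (n + ρ1) ≤ 2 * ρ) (hc12 : 2 * t0 * n + t1 * (n + ρ1) ≤ 2 * ρ) :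
    t0 * (1 - (y ^ 2 + (1 - y) * ρ) / n) + t1 * (1 - (y ^ 2 + (1 - y) * ρ) / (y ^ 2 + (1 - y) * ρ1))
      ≤ (1 - t0 - t1) * (y ^ 2 + (1 - y) * ρ) * ((1 - y) / y) := by
  by_cases hyh : y ≤ 1 / 2
  · exact diag_lightPlus_half y ρ ρ1 t0 t1 n hy0 hyh hρ0 hρ1 hρ1y hn ht0 ht1 hs1 hc11 hc12
  · exact diag_lightPlus_big y ρ ρ1 t0 t1 n (lt_of_not_ge hyh).le hy1 hρ0 hρ1 hρ1y hn ht0 ht1 hs1 hc11 hc12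

end LawDec
end Quant
end Summit.CriticalPhenomena.PercolationContinuityZ3.Theorems
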